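import Mathlib
import Summits.Parity.BatemanHorn.Theorems.IsogenyRedeiLambdaToCount
import HarnessLib

/-!
# Route VanishingDimension — support `PrimeCellExtraction` (item stmt-Parity-18607): helpers

Helper lemmas for the proof of
`Summit.Parity.BatemanHorn.Theses.VanishingDimension.PrimeCellExtraction`
(file `VanishingDimensionPrimeCellExtraction.lean`):

* the main scale `x/(log x)^k → ∞` and `x^a = o(x/(log x)^k)` (`a < 1`) along `ℕ`;
* the abstract extraction lemma `extraction`: a sandwich `|S_z − A_z V_z| ≤ ε A_z V_z`, a
  calibration `|(log x)^k A_z V_z/(z^k x) − c| ≤ ε` (both for all small `z`, eventually in `x`)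
  and cell bounds `z^k (P − E₁) ≤ S_z ≤ N₀ + z^k (P + E₂) + z^{k+1} C x/(log x)^k` with
  `E₁, E₂ = o(x/(log x)^k)` give `P(x) ~ c x/(log x)^k` (choose `ε`, then a fixed small `z`,
  then `x → ∞`);
* the arithmetic of the tilt exponent `Σᵢ ω(Mᵢ)`: `= k` on prime tuples, `≥ k` when all `Mᵢ ≥ 2`,
  `≥ k + 1` when moreover some `Mᵢ` is neither prime nor a proper prime power;
* prime tuples `n ≤ x` with a coordinate `fᵢ(n)` divisible by a prime `p < y` number
  `≤ y Σᵢ deg fᵢ`.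
-/

open Finset Filter Asymptotics Polynomial ArithmeticFunction
open scoped Classical Topology ArithmeticFunction.omega

namespace Summit.Parity.BatemanHorn.Theorems.PrimeCellExtraction

/-! ### Real analysis: the main scale `x/(log x)^k` and the abstract extraction lemma -/

/-- `x / (log x)^k → ∞` along `ℕ`. -/
theorem tendsto_div_log_pow_atTop (k : ℕ) :
    Tendsto (fun x : ℕ => (x : ℝ) / Real.log x ^ k) atTop atTop := by
  have h := LambdaToCount.tendsto_norm_main_term (C := 1) (D := 1) one_pos one_pos k
  refine h.congr fun x => ?_
  rw [div_one, one_mul, Real.norm_of_nonneg]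
  exact div_nonneg (Nat.cast_nonneg _) (pow_nonneg (Real.log_natCast_nonneg x) k)

/-- `x^a = o(x/(log x)^k)` along `ℕ` for `a < 1`. -/
theorem isLittleO_rpow_div_log_pow {a : ℝ} (ha : a < 1) (k : ℕ) :
    (fun x : ℕ => (x : ℝ) ^ a) =o[atTop] fun x : ℕ => (x : ℝ) / Real.log x ^ k := by
  have h := LambdaToCount.isLittleO_log_pow_mul_rpow ha k
  refine isLittleO_iff.mpr fun c hc => ?_
  filter_upwards [h.bound hc, eventually_ge_atTop 2] with x hx hx2
  have hlog : 0 < Real.log x := Real.log_pos (by exact_mod_cast hx2)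
  have hx0 : (0 : ℝ) < x := by positivity
  rw [Real.norm_of_nonneg (by positivity), Real.norm_of_nonneg (by positivity),
    Real.rpow_one] at hx
  rw [Real.norm_of_nonneg (by positivity), Real.norm_of_nonneg (by positivity),
    ← mul_div_assoc, le_div_iff₀ (pow_pos hlog k)]
  linarith [mul_comm (Real.log x ^ k) ((x : ℝ) ^ a)]

/-- The pointwise algebra of the extraction: from the sandwich `|S − AV| ≤ ε AV`, the rescaled
calibration `|AV − c z^k L| ≤ ε z^k L`, the cell bounds `z^k (P − E₁) ≤ S ≤ N + z^k (P + E₂) +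
z^k z C L` and the smallness of `E₁, E₂, N/z^k, z C L` against `L`, conclude
`|P − c L| ≤ η c L`. -/
theorem extraction_arith {c ε η zk z L P E₁ E₂ S AV N C : ℝ} (hc : 0 < c) (hε0 : 0 < ε)
    (hε1 : ε ≤ 1 / 2) (hεη : ε * (c + 3) ≤ η * c / 2) (hη : 0 < η) (hzk : 0 < zk) (hL : 0 < L)
    (hShi : S - AV ≤ ε * AV) (hSlo : AV - S ≤ ε * AV)
    (hMhi : AV - c * (zk * L) ≤ ε * (zk * L)) (hMlo : c * (zk * L) - AV ≤ ε * (zk * L))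
    (hlo : zk * (P - E₁) ≤ S) (hup : S ≤ N + zk * (P + E₂) + zk * z * C * L)
    (hE1 : E₁ ≤ ε * L) (hE2 : E₂ ≤ ε / 2 * L) (hN : N / zk ≤ ε / 2 * L)
    (hzC : z * C * L ≤ ε * L) : |P - c * L| ≤ η * (c * L) := by
  have hεε : ε ^ 2 ≤ ε := by nlinarith
  have hεL : ε ^ 2 * L ≤ ε * L := mul_le_mul_of_nonneg_right hεε hL.le
  have hε2L : 0 ≤ ε ^ 2 * L := by positivity
  -- upper bound for `P`
  have hAVhi : AV ≤ (c + ε) * (zk * L) := by linarith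
  have hS1 : S ≤ (1 + ε) * ((c + ε) * (zk * L)) :=
    calc S ≤ (1 + ε) * AV := by linarith
      _ ≤ (1 + ε) * ((c + ε) * (zk * L)) := mul_le_mul_of_nonneg_left hAVhi (by linarith)
  have hP1 : P - E₁ ≤ (1 + ε) * (c + ε) * L := by
    refine le_of_mul_le_mul_left ?_ hzk
    calc zk * (P - E₁) ≤ S := hlo
      _ ≤ (1 + ε) * ((c + ε) * (zk * L)) := hS1
      _ = zk * ((1 + ε) * (c + ε) * L) := by ring
  have hPhi : P ≤ (c + ε * (c + 3)) * L := by linarith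
  -- lower bound for `P`
  have hAVlo : (c - ε) * (zk * L) ≤ AV := by linarith
  have hS2 : (1 - ε) * ((c - ε) * (zk * L)) ≤ S :=
    calc (1 - ε) * ((c - ε) * (zk * L)) ≤ (1 - ε) * AV :=
          mul_le_mul_of_nonneg_left hAVlo (by linarith)
      _ ≤ S := by linarith
  have hP2 : (1 - ε) * (c - ε) * L ≤ N / zk + P + E₂ + z * C * L := by
    refine le_of_mul_le_mul_left ?_ hzk
    calc zk * ((1 - ε) * (c - ε) * L) = (1 - ε) * ((c - ε) * (zk * L)) := by ring
      _ ≤ S := hS2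
      _ ≤ N + zk * (P + E₂) + zk * z * C * L := hup
      _ = zk * (N / zk + P + E₂ + z * C * L) := by
          rw [show zk * (N / zk + P + E₂ + z * C * L) =
              zk * (N / zk) + zk * (P + E₂) + zk * z * C * L by ring, mul_div_cancel₀ _ hzk.ne']
  have hPlo : (c - ε * (c + 3)) * L ≤ P := by linarith
  -- conclusion
  have h7 : ε * (c + 3) * L ≤ η * c / 2 * L := mul_le_mul_of_nonneg_right hεη hL.le
  have h8 : 0 ≤ η * (c * L) := by positivity
  rw [abs_le]
  constructor <;> linarith

/-- **Abstract extraction.** Let `S_z(x)` (the sifted tilted mass), `A_z(x) V_z(x)` (its model),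
`P(x)` (the count to be extracted) satisfy: the sandwich `|S − AV| ≤ ε AV` and the calibration
`|(log x)^k A V/(z^k x) − c| ≤ ε` for all small `z` eventually in `x`; the cell bounds
`z^k (P − E₁) ≤ S ≤ N₀ + z^k (P + E₂) + z^{k+1} C x/(log x)^k` for `0 < z ≤ 1` eventually in `x`,
with `E₁, E₂ = o(x/(log x)^k)`. Then `P(x) ~ c x/(log x)^k` (`c > 0`). -/
theorem extraction {k : ℕ} {c C N₀ : ℝ} (hc : 0 < c) {P E₁ E₂ : ℕ → ℝ} {S A V : ℝ → ℕ → ℝ}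
    (h1 : ∀ ε : ℝ, 0 < ε → ∃ z₁ : ℝ, 0 < z₁ ∧ ∀ z : ℝ, 0 < z → z < z₁ →
      ∀ᶠ x : ℕ in atTop, |S z x - A z x * V z x| ≤ ε * (A z x * V z x))
    (h2 : ∀ ε : ℝ, 0 < ε → ∃ z₂ : ℝ, 0 < z₂ ∧ ∀ z : ℝ, 0 < z → z < z₂ →
      ∀ᶠ x : ℕ in atTop, |Real.log x ^ k * A z x * V z x / (z ^ k * (x : ℝ)) - c| ≤ ε)
    (hlo : ∀ z : ℝ, 0 < z → z ≤ 1 → ∀ᶠ x : ℕ in atTop, z ^ k * (P x - E₁ x) ≤ S z x)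
    (hup : ∀ z : ℝ, 0 < z → z ≤ 1 → ∀ᶠ x : ℕ in atTop,
      S z x ≤ N₀ + z ^ k * (P x + E₂ x) + z ^ (k + 1) * C * ((x : ℝ) / Real.log x ^ k))
    (hE₁ : E₁ =o[atTop] fun x : ℕ => (x : ℝ) / Real.log x ^ k)
    (hE₂ : E₂ =o[atTop] fun x : ℕ => (x : ℝ) / Real.log x ^ k) :
    P ~[atTop] fun x : ℕ => c * ((x : ℝ) / Real.log x ^ k) := by
  set L : ℕ → ℝ := fun x => (x : ℝ) / Real.log x ^ k with hL
  have hLtop : Tendsto L atTop atTop := tendsto_div_log_pow_atTop k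
  show (P - fun x : ℕ => c * L x) =o[atTop] fun x : ℕ => c * L x
  refine isLittleO_iff.mpr fun η hη => ?_
  -- choice of ε
  obtain ⟨ε, hε0, hε1, hεη⟩ : ∃ ε : ℝ, 0 < ε ∧ ε ≤ 1 / 2 ∧ ε * (c + 3) ≤ η * c / 2 := by
    have hc3 : 0 < c + 3 := by linarith
    refine ⟨min (1 / 2) (η * c / (2 * (c + 3))), lt_min (by norm_num) (by positivity),
      min_le_left _ _, ?_⟩
    calc min (1 / 2) (η * c / (2 * (c + 3))) * (c + 3)
        ≤ η * c / (2 * (c + 3)) * (c + 3) :=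
          mul_le_mul_of_nonneg_right (min_le_right _ _) hc3.le
      _ = η * c / 2 := by
          field_simp
  obtain ⟨z₁, hz₁, H1⟩ := h1 ε hε0
  obtain ⟨z₂, hz₂, H2⟩ := h2 ε hε0
  -- choice of z
  obtain ⟨z, hz0, hzz₁, hzz₂, hz1, hzC⟩ :
      ∃ z : ℝ, 0 < z ∧ z < z₁ ∧ z < z₂ ∧ z ≤ 1 ∧ z * |C| ≤ ε := by
    have hC1 : 0 < |C| + 1 := by positivity
    have hq : 0 < ε / (|C| + 1) := div_pos hε0 hC1
    set z₀ := min (min z₁ z₂) (min 1 (ε / (|C| + 1))) with hz₀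
    have hz₀pos : 0 < z₀ := lt_min (lt_min hz₁ hz₂) (lt_min one_pos hq)
    have ha : z₀ ≤ z₁ := (min_le_left _ _).trans (min_le_left _ _)
    have hb : z₀ ≤ z₂ := (min_le_left _ _).trans (min_le_right _ _)
    have hc' : z₀ ≤ 1 := (min_le_right _ _).trans (min_le_left _ _)
    have hd : z₀ ≤ ε / (|C| + 1) := (min_le_right _ _).trans (min_le_right _ _)
    refine ⟨z₀ / 2, by positivity, by linarith, by linarith, by linarith, ?_⟩
    have h' : z₀ / 2 ≤ ε / (|C| + 1) := by linarith
    calc z₀ / 2 * |C| ≤ ε / (|C| + 1) * |C| := mul_le_mul_of_nonneg_right h' (abs_nonneg C)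
      _ ≤ ε / (|C| + 1) * (|C| + 1) := mul_le_mul_of_nonneg_left (by linarith) hq.le
      _ = ε := div_mul_cancel₀ _ hC1.ne'
  have hzk : 0 < z ^ k := pow_pos hz0 k
  have hN₀ : ∀ᶠ x : ℕ in atTop, |N₀| / z ^ k / (ε / 2) ≤ L x := hLtop.eventually_ge_atTop _
  filter_upwards [H1 z hz0 hzz₁, H2 z hz0 hzz₂, hlo z hz0 hz1, hup z hz0 hz1, hE₁.bound hε0,
    hE₂.bound (half_pos hε0), hN₀, eventually_ge_atTop 2] with x hS hM hlo' hup' hE1 hE2 hN0 hx2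
  have hlogx : 0 < Real.log x := Real.log_pos (by exact_mod_cast hx2)
  have hx0 : (0 : ℝ) < x := by positivity
  have hLx : 0 < L x := div_pos hx0 (pow_pos hlogx k)
  have hzL : 0 < z ^ k * L x := mul_pos hzk hLx
  -- the calibration, rescaled: `|A V − c z^k L| ≤ ε z^k L`
  have hx0' : (x : ℝ) ≠ 0 := hx0.ne'
  have hlog0 : Real.log x ≠ 0 := hlogx.ne'
  have hz0' : z ≠ 0 := hz0.ne'
  have hkey : Real.log x ^ k * A z x * V z x / (z ^ k * (x : ℝ)) =
      A z x * V z x / (z ^ k * L x) := by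
    rw [div_eq_div_iff (by positivity) hzL.ne', hL]
    field_simp
  rw [hkey] at hM
  have hM' : |A z x * V z x - c * (z ^ k * L x)| ≤ ε * (z ^ k * L x) := by
    have e : A z x * V z x - c * (z ^ k * L x) =
        (A z x * V z x / (z ^ k * L x) - c) * (z ^ k * L x) := by
      rw [sub_mul, div_mul_cancel₀ _ hzL.ne']
    rw [e, abs_mul, abs_of_pos hzL]
    exact mul_le_mul_of_nonneg_right hM hzL.le
  obtain ⟨hMhi, hMlo⟩ := abs_sub_le_iff.mp hM'
  obtain ⟨hShi, hSlo⟩ := abs_sub_le_iff.mp hS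
  -- the error terms
  rw [Real.norm_of_nonneg hLx.le, Real.norm_eq_abs] at hE1 hE2
  have hE1le : E₁ x ≤ ε * L x := (le_abs_self _).trans hE1
  have hE2le : E₂ x ≤ ε / 2 * L x := (le_abs_self _).trans hE2
  have hN0' : N₀ / z ^ k ≤ ε / 2 * L x := by
    have h' : |N₀| / z ^ k ≤ ε / 2 * L x := by
      rw [div_le_iff₀ (half_pos hε0)] at hN0
      linarith
    exact (div_le_div_of_nonneg_right (le_abs_self N₀) hzk.le).trans h'
  have hzCL : z * C * L x ≤ ε * L x := by
    refine mul_le_mul_of_nonneg_right ?_ hLx.le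
    exact (mul_le_mul_of_nonneg_left (le_abs_self C) hz0.le).trans hzC
  have hup'' : S z x ≤ N₀ + z ^ k * (P x + E₂ x) + z ^ k * z * C * L x := by
    rw [← pow_succ]
    exact hup'
  have key := extraction_arith (c := c) (ε := ε) (η := η) (zk := z ^ k) (z := z) (L := L x)
    (P := P x) (E₁ := E₁ x) (E₂ := E₂ x) (S := S z x) (AV := A z x * V z x) (N := N₀) (C := C)
    hc hε0 hε1 hεη hη hzk hLx hShi hSlo hMhi hMlo hlo' hup'' hE1le hE2le hN0' hzCL
  simp only [Pi.sub_apply, Real.norm_eq_abs]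
  rw [abs_of_pos (mul_pos hc hLx)]
  exact key

/-! ### Arithmetic of the weights `z^{Σᵢ ω(fᵢ(n))}` -/

/-- On a prime tuple `Σᵢ ω(Mᵢ) = k`. -/
theorem sum_cardDistinctFactors_eq_of_prime {k : ℕ} {M : Fin k → ℕ} (h : ∀ i, (M i).Prime) :
    ∑ i, ω (M i) = k := by
  rw [sum_congr rfl fun i _ => cardDistinctFactors_apply_prime (h i), sum_const, card_univ,
    Fintype.card_fin, smul_eq_mul, mul_one]

/-- If all `Mᵢ ≥ 2` then `Σᵢ ω(Mᵢ) ≥ k`. -/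
theorem le_sum_cardDistinctFactors {k : ℕ} {M : Fin k → ℕ} (h : ∀ i, 2 ≤ M i) :
    k ≤ ∑ i, ω (M i) := by
  have := card_nsmul_le_sum (univ : Finset (Fin k)) (fun i => ω (M i)) 1
    fun i _ => cardDistinctFactors_pos.mpr (h i)
  simpa using this

/-- An integer `M ≥ 2` which is neither a prime nor a proper prime power has `ω(M) ≥ 2`. -/
theorem two_le_cardDistinctFactors {M : ℕ} (hM : 2 ≤ M) (hnp : ¬M.Prime)
    (hnpow : ∀ p a : ℕ, p.Prime → 2 ≤ a → M ≠ p ^ a) : 2 ≤ ω M := by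
  have hnot : ¬IsPrimePow M := by
    intro h
    obtain ⟨p, a, hp, ha, hpa⟩ := (isPrimePow_nat_iff M).mp h
    rcases (show a = 1 ∨ 2 ≤ a by omega) with rfl | ha2
    · rw [pow_one] at hpa
      exact hnp (hpa ▸ hp)
    · exact hnpow p a hp ha2 hpa.symm
  have h1 : 0 < ω M := cardDistinctFactors_pos.mpr hM
  have h2 : ω M ≠ 1 := fun h => hnot (cardDistinctFactors_eq_one_iff.mp h)
  omega

/-- If all `Mᵢ ≥ 2` and some `M_{i₀}` has `ω ≥ 2`, then `Σᵢ ω(Mᵢ) ≥ k + 1`. -/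
theorem succ_le_sum_cardDistinctFactors {k : ℕ} {M : Fin k → ℕ} (h : ∀ i, 2 ≤ M i) {i₀ : Fin k}
    (hi₀ : 2 ≤ ω (M i₀)) : k + 1 ≤ ∑ i, ω (M i) := by
  have hk : 0 < k := i₀.pos
  have hrest : (univ.erase i₀).card • 1 ≤ ∑ i ∈ univ.erase i₀, ω (M i) :=
    card_nsmul_le_sum _ _ 1 fun i _ => cardDistinctFactors_pos.mpr (h i)
  rw [card_erase_of_mem (mem_univ _), card_univ, Fintype.card_fin, smul_eq_mul, mul_one] at hrest
  calc k + 1 = (k - 1) + 2 := by omega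
    _ ≤ ∑ i ∈ univ.erase i₀, ω (M i) + ω (M i₀) := add_le_add hrest hi₀
    _ = ∑ i, ω (M i) := sum_erase_add _ _ (mem_univ _)

/-! ### Prime tuples with a small prime coordinate -/

/-- Prime tuples `n ≤ x` with some `fᵢ(n)` divisible by (hence equal to) a prime `p < y` number at
most `y · Σᵢ deg fᵢ`. -/
theorem card_filter_good_dvd_le {k : ℕ} (f : Fin k → ℤ[X]) (hd : ∀ i, 0 < (f i).natDegree)
    (x y : ℕ) :
    #((Icc 1 x).filter fun n : ℕ =>
        (∀ i, 0 < (f i).eval (n : ℤ) ∧ (((f i).eval (n : ℤ)).toNat).Prime) ∧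
          ∃ i, ∃ p ∈ range y, p.Prime ∧ (p : ℤ) ∣ (f i).eval (n : ℤ)) ≤
      y * ∑ i, (f i).natDegree := by
  calc #((Icc 1 x).filter fun n : ℕ =>
          (∀ i, 0 < (f i).eval (n : ℤ) ∧ (((f i).eval (n : ℤ)).toNat).Prime) ∧
            ∃ i, ∃ p ∈ range y, p.Prime ∧ (p : ℤ) ∣ (f i).eval (n : ℤ))
      ≤ #((univ : Finset (Fin k)).biUnion fun i => (range y).biUnion fun p =>
          (Icc 1 x).filter fun n : ℕ => (f i).eval (n : ℤ) = (p : ℤ)) := by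
        refine card_le_card fun n hn => ?_
        rw [mem_filter] at hn
        obtain ⟨hn, hgood, i, p, hp, hpp, hdvd⟩ := hn
        rw [mem_biUnion]
        refine ⟨i, mem_univ _, ?_⟩
        rw [mem_biUnion]
        refine ⟨p, hp, mem_filter.mpr ⟨hn, ?_⟩⟩
        obtain ⟨hpos, hprime⟩ := hgood i
        have hcast : ((((f i).eval (n : ℤ)).toNat : ℕ) : ℤ) = (f i).eval (n : ℤ) :=
          Int.toNat_of_nonneg hpos.le
        rw [← hcast] at hdvd ⊢
        have hdvd' : p ∣ ((f i).eval (n : ℤ)).toNat := Int.natCast_dvd_natCast.mp hdvd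
        rw [(Nat.prime_dvd_prime_iff_eq hpp hprime).mp hdvd']
    _ ≤ ∑ i, #((range y).biUnion fun p =>
          (Icc 1 x).filter fun n : ℕ => (f i).eval (n : ℤ) = (p : ℤ)) := card_biUnion_le
    _ ≤ ∑ i, ∑ p ∈ range y, #((Icc 1 x).filter fun n : ℕ => (f i).eval (n : ℤ) = (p : ℤ)) :=
        sum_le_sum fun i _ => card_biUnion_le
    _ ≤ ∑ i, ∑ _p ∈ range y, (f i).natDegree :=
        sum_le_sum fun i _ => sum_le_sum fun p _ => LambdaToCount.card_filter_eval_eq_le (hd i) x _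
    _ = y * ∑ i, (f i).natDegree := by
        rw [mul_sum]
        refine sum_congr rfl fun i _ => ?_
        rw [sum_const, card_range, smul_eq_mul]

end Summit.Parity.BatemanHorn.Theorems.PrimeCellExtraction
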